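import Summits.ResolutionOfSingularities.ResolutionOfSingularities.Theorems.FrobeniusClosingSteerCurveLineageRegular
import Literature.AlgebraicGeometry.Resolution.BlowupPointSubalgebra
import Literature.AlgebraicGeometry.Resolution.QuadraticTransforms
import Mathlib.RingTheory.Ideal.Quotient.Operations
import Mathlib.RingTheory.LocalRing.RingHom.Basic
import HarnessLib

/-!
# The lineage of a curve germ read in a residue frame becomes regular (D3c of the σ-residual LOW half, W4.1)

W4.1, crux `Steer` (stmt-ResolutionOfSingularities-16345), σ-line at `p = 2`, LOW half, piece **D3c = F5 TAMING**
(res-L0-w41-plan-1 RULING 18d / 41; res-L0-w41-strat-2 §σ2.24 `LowTowerTamingTwo` over the interface `IsLowTowerTwo`).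
Theses-free, def-free. THE FRAME LEMMA of the taming argument (F5 (ii)+(iii) of res-L0-w41-idea-3's card 3 v3):

Along the LOW tower `A 0 ≤ A 1 ≤ ⋯` (subrings of one field `L`), follow ONE curve — a compatible family of primes
`𝔮 n ⊂ A n` (`𝔮 (n+1) ∩ A n = 𝔮 n`). Read everything in a RESIDUE FRAME `(Λ, φ)`: a subring `Λ ≤ L` containing every
`A n` (in the application: the common local ring `(A n)_{𝔮 n}` of the curve, realised in `L`) and a ring map
`φ : Λ → κ` onto fractions whose kernel cuts out the curve (`z ∈ 𝔮 n ↔ φ z = 0`). Then the GERMS `φ(A n) ⊆ κ` of the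
curve are isomorphic to `A n ⧸ 𝔮 n`, and if every step of the tower is the identity or a quadratic transform ON THE GERMS
(res-D-pv-012's (M1) one level down) with infinitely many quadratic transforms, the curve-lineage theorem
`CurveLineage.eventually_isDiscreteValuationRing_of_lineage` (p515973) makes the germs — hence the quotients `A n ⧸ 𝔮 n` —
REGULAR from some stage on: a BAD curve (singular for the torsor, non-regular quotient) does not stay bad for ever.

* `range_comp_inclusion_eq_map_comap` — the germ `φ(A)` as `RingHom.range` and as `Subring.map` agree;
* `ker_comp_inclusion_eq` — the kernel of `A n → Λ → κ` is `𝔮 n`;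
* `quotientEquivGerm_exists` — `A n ⧸ 𝔮 n ≃+* φ(A n)`;
* `eventually_isRegularLocalRing_quotient_of_frame` — **the frame lemma**.

No Theses file of W4.1 is imported; nothing here is a route item. OURS (the W4.1 engine), standard commutative algebra;
NOT a statement of the manuscript under review [claim: Hironaka2017, status: under-review]. [cite: Kollar2007, §1.4, Thm. 1.101]
[cite: Cutkosky2014, §2.1] [folklore]
-/

noncomputable section

-- `Summit.<S>.<S>.…` duplicates the summit name by design (single-problem summit).
set_option linter.dupNamespace false

open IsLocalRing Literature.AlgebraicGeometry.Resolution

namespace Summit.ResolutionOfSingularities.ResolutionOfSingularities.Theorems.SwitchingDichotomy.LineageFrame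

variable {L κ : Type} [Field L] [Field κ]

/-! ## §1 Germs in a frame -/

/-- The germ of `A ≤ Λ` under `φ` as a `RingHom.range` is the `Subring.map` of `A` pulled back to `Λ`. [folklore] -/
theorem range_comp_inclusion_eq_map_comap (Λ : Subring L) (φ : Λ →+* κ) {A : Subring L} (hA : A ≤ Λ) :
    (φ.comp (Subring.inclusion hA)).range = (A.comap Λ.subtype).map φ := by
  ext c
  simp only [RingHom.mem_range, RingHom.coe_comp, Function.comp_apply, Subring.mem_map, Subring.mem_comap,
    Subring.coe_subtype]
  constructor
  · rintro ⟨a, rfl⟩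
    exact ⟨Subring.inclusion hA a, a.2, rfl⟩
  · rintro ⟨r, hr, rfl⟩
    exact ⟨⟨(r : L), hr⟩, by congr 1⟩

/-- If `φ` cuts out `𝔮` on `A` (`z ∈ 𝔮 ↔ φ z = 0`), the kernel of `A → Λ → κ` is `𝔮`. [folklore] -/
theorem ker_comp_inclusion_eq (Λ : Subring L) (φ : Λ →+* κ) {A : Subring L} (hA : A ≤ Λ) (𝔮 : Ideal A)
    (hker : ∀ z : A, z ∈ 𝔮 ↔ φ (Subring.inclusion hA z) = 0) :
    RingHom.ker (φ.comp (Subring.inclusion hA)) = 𝔮 := by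
  ext z
  rw [RingHom.mem_ker, RingHom.coe_comp, Function.comp_apply, ← hker]

/-- **The germ is the quotient**: `A ⧸ 𝔮 ≃+* φ(A)` (first isomorphism theorem). [folklore] -/
theorem quotientEquivGerm_exists (Λ : Subring L) (φ : Λ →+* κ) {A : Subring L} (hA : A ≤ Λ) (𝔮 : Ideal A)
    (hker : ∀ z : A, z ∈ 𝔮 ↔ φ (Subring.inclusion hA z) = 0) :
    Nonempty (A ⧸ 𝔮 ≃+* (φ.comp (Subring.inclusion hA)).range) := by
  have hk := ker_comp_inclusion_eq Λ φ hA 𝔮 hker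
  exact ⟨(Ideal.quotEquivOfEq hk.symm).trans (RingHom.quotientKerEquivRange (φ.comp (Subring.inclusion hA)))⟩

/-! ## §2 The frame lemma -/

/-- **The lineage of a curve read in a residue frame becomes regular.** Data: a chain `A : ℕ → Subring L` inside a
subring `Λ`, a ring map `φ : Λ → κ` to a field, primes `𝔮 n ⊂ A n` cut out by `φ` (`z ∈ 𝔮 n ↔ φ z = 0`); the germ
`φ(A 0)` has all of `κ` as fractions; `A 0 ⧸ 𝔮 0` is a Noetherian local domain of dimension one with module-finite
normalisation (an excellent curve germ); every step is the identity or a quadratic transform on the germs, with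
infinitely many quadratic transforms. Then `A n ⧸ 𝔮 n` is a regular local ring for all large `n`.
[cite: Kollar2007, §1.4, Thm. 1.101] [cite: Cutkosky2014, §2.1] -/
theorem eventually_isRegularLocalRing_quotient_of_frame (Λ : Subring L) (φ : Λ →+* κ)
    (A : ℕ → Subring L) (hAΛ : ∀ n, A n ≤ Λ) (𝔮 : (n : ℕ) → Ideal (A n)) [∀ n, (𝔮 n).IsPrime]
    (hker : ∀ n (z : A n), z ∈ 𝔮 n ↔ φ (Subring.inclusion (hAΛ n) z) = 0)
    (hκ : ∀ c : κ, ∃ a ∈ (φ.comp (Subring.inclusion (hAΛ 0))).range,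
      ∃ b ∈ (φ.comp (Subring.inclusion (hAΛ 0))).range, b ≠ 0 ∧ c = a / b)
    (hloc : IsLocalRing (A 0 ⧸ 𝔮 0)) (hN : IsNoetherianRing (A 0 ⧸ 𝔮 0))
    (hdim : ringKrullDim (A 0 ⧸ 𝔮 0) = 1)
    (hfin : Module.Finite (A 0 ⧸ 𝔮 0) (integralClosure (A 0 ⧸ 𝔮 0) (FractionRing (A 0 ⧸ 𝔮 0))))
    (hstep : ∀ n, (φ.comp (Subring.inclusion (hAΛ (n + 1)))).range = (φ.comp (Subring.inclusion (hAΛ n))).range ∨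
      IsQuadraticTransform (φ.comp (Subring.inclusion (hAΛ n))).range (φ.comp (Subring.inclusion (hAΛ (n + 1)))).range)
    (hinf : ∀ n₀, ∃ n, n₀ ≤ n ∧
      IsQuadraticTransform (φ.comp (Subring.inclusion (hAΛ n))).range (φ.comp (Subring.inclusion (hAΛ (n + 1)))).range) :
    ∃ n₀, ∀ n, n₀ ≤ n → IsRegularLocalRing (A n ⧸ 𝔮 n) := by
  classical
  -- the germs
  set G : ℕ → Subring κ := fun n => (φ.comp (Subring.inclusion (hAΛ n))).range with hG
  have e : ∀ n, Nonempty (A n ⧸ 𝔮 n ≃+* G n) := fun n => quotientEquivGerm_exists Λ φ (hAΛ n) (𝔮 n) (hker n)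
  obtain ⟨e0⟩ := e 0
  -- the class of `G 0`
  haveI : IsDomain (A 0 ⧸ 𝔮 0) := (Ideal.Quotient.isDomain_iff_prime _).mpr inferInstance
  haveI := hloc
  haveI := hN
  haveI := hfin
  have hof : IsLocalRingOf (G 0) := by
    refine ⟨IsLocalRing.of_surjective' e0.toRingHom e0.surjective, fun c => ?_⟩
    obtain ⟨a, ha, b, hb, hb0, rfl⟩ := hκ c
    exact ⟨a, ha, b, hb, hb0, rfl⟩
  have hN' : IsNoetherianRing (G 0) := isNoetherianRing_of_ringEquiv (A 0 ⧸ 𝔮 0) e0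
  have hdim' : ringKrullDim (G 0) = 1 := (ringKrullDim_eq_of_ringEquiv e0) ▸ hdim
  haveI : IsFractionRing (G 0) κ := isFractionRing_of_isLocalRingOf_le hof.2 le_rfl
  have hfin' : Module.Finite (G 0) (integralClosure (G 0) κ) :=
    module_finite_integralClosure_of_ringEquiv e0 (FractionRing (A 0 ⧸ 𝔮 0)) κ
  obtain ⟨n₀, hn₀⟩ := CurveLineage.eventually_isDiscreteValuationRing_of_lineage G hof hN' hdim' hfin' hstep hinf
  refine ⟨n₀, fun n hn => ?_⟩
  haveI := hn₀ n hn
  obtain ⟨en⟩ := e n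
  haveI : IsRegularLocalRing (G n) := inferInstance
  exact IsRegularLocalRing.of_ringEquiv en.symm

end Summit.ResolutionOfSingularities.ResolutionOfSingularities.Theorems.SwitchingDichotomy.LineageFrame

end
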